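import Literature.AnabelianGeometry.SemiGraphs.TemperedEdgeLikeHostThroughBranch
import Literature.AnabelianGeometry.SemiGraphs.MorphismsOver
import Mathlib.GroupTheory.Commensurable
import HarnessLib

/-!
# [SemiAnbd] Thm. 3.7 (ii)–(iv): commensurable edge-like subgroups of ONE edge are EQUAL — for every edge, open
# edges (cusps) included, from Thm. 3.7 (iii) at `𝒢`

Mochizuki, *Semi-graphs of anabelioids*, Publ. RIMS **42** (2006), §3, Thm. 3.7 (ii)–(iv) pp. 40–41
[cite: MochizukiSemiAnbd2006, Thm 3.7(iii) pp.40-41], Def. 2.4 (iv) p. 26 ("aloof": `Π_b ∩ g·Π_b·g⁻¹` has infinite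
index in `Π_b` for `g ∉ Π_b`).

PROOF-ONLY brick (abc-iut cell, layer L3, seat abc-iut-L3-t2 gen 5, row «Ex310-GRAPH-ACTION», part G″; no
definition, no instance, no new named fact):
* `eq_of_commensurable_of_mem_edgeLikeSubgroups_of_compactInVerticialAt` — for `𝒢` as in Thm. 3.7 with Thm. 3.7 (iii)
  AT `𝒢` (`CompactInVerticialAt 𝒢`, a theorem for finite `𝒢`), two COMMENSURABLE edge-like subgroups `L, L'` of the
  same edge `e` are EQUAL.  No `IsGraph` hypothesis: this is the commensurable-rigidity binder `hCT` of
  `SpecialFibreTowerOfCoveringsFibres.lean` / `…GraphAction.lean` discharged for ALL edges, cusps included (the tree's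
  `eq_of_commensurable_of_mem_edgeLikeSubgroupsAt` wants a graph).
Proof: present `L = g·φ(Π_b)·g⁻¹`, `L' = g'·φ(Π_b)·g'⁻¹` through a branch `b` of `e` at `v`; the compact nontrivial
`L ∩ L'` lies in both hosts `g·φ(Π_v)·g⁻¹`, `g'·φ(Π_v)·g'⁻¹`, which therefore coincide (else Thm. 3.7 (iii) at `𝒢`
puts `L ∩ L'` in an edge-like subgroup of a closed edge `e' = e`, whose host through the other branch would be a host
through `b` — LEMMA E); so `g' = g·φ(p)` with `p ∈ Π_v` (verticial subgroups are commensurably terminal, Thm. 3.7 (ii)),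
and `Π_b ∼ p·Π_b·p⁻¹` forces `p ∈ Π_b` (aloofness), i.e. `L' = L`.  Nothing here is about curves; no side is taken on
[IUTchIII] Cor. 3.12.
-/

noncomputable section

open CategoryTheory Topology

namespace Literature.AnabelianGeometry.SemiGraphs

namespace ProfiniteSemiGraph

universe u

variable {𝒢 : ProfiniteSemiGraph.{u}}

/-- `(g h) K (g h)⁻¹ = g (h K h⁻¹) g⁻¹`. [folklore] -/
private theorem map_conj_mul₃ {G : Type u} [Group G] (K : Subgroup G) (g h : G) :
    K.map (MulAut.conj (g * h)).toMonoidHom = (K.map (MulAut.conj h).toMonoidHom).map (MulAut.conj g).toMonoidHom := by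
  rw [map_mul, Subgroup.map_map]; rfl

/-- `Φ(p A p⁻¹) = Φ(p) Φ(A) Φ(p)⁻¹`. [folklore] -/
private theorem map_conj_map_hom {Γ Λ : Type u} [Group Γ] [Group Λ] [TopologicalSpace Γ] [TopologicalSpace Λ]
    (Φ : Γ →ₜ* Λ) (A : Subgroup Γ) (p : Γ) :
    (A.map (MulAut.conj p).toMonoidHom).map Φ.toMonoidHom =
      (A.map Φ.toMonoidHom).map (MulAut.conj (Φ p)).toMonoidHom := by
  rw [Subgroup.map_map, Subgroup.map_map]
  congr 1
  ext a
  show Φ (p * a * p⁻¹) = Φ p * Φ a * (Φ p)⁻¹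
  rw [map_mul, map_mul, map_inv]

/-- Conjugating a subgroup by one of its elements does not change it. [folklore] -/
private theorem map_conj_eq_self_of_mem₃ {G : Type u} [Group G] {K : Subgroup G} {g : G} (hg : g ∈ K) :
    K.map (MulAut.conj g).toMonoidHom = K := by
  ext x
  constructor
  · rintro ⟨y, hy, rfl⟩
    exact K.mul_mem (K.mul_mem hg hy) (K.inv_mem hg)
  · intro hx
    exact ⟨g⁻¹ * x * g, K.mul_mem (K.mul_mem (K.inv_mem hg) hx) hg, by
      simp only [MulEquiv.coe_toMonoidHom, MulAut.conj_apply]; group⟩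

/-- **Commensurable edge-like subgroups of one edge are equal — every edge, cusps included** (from Thm. 3.7 (iii)
AT `𝒢`).  See the module docstring for the proof. [cite: MochizukiSemiAnbd2006, Thm 3.7(iii) pp.40-41] -/
theorem eq_of_commensurable_of_mem_edgeLikeSubgroups_of_compactInVerticialAt (hCV : CompactInVerticialAt 𝒢)
    (h𝒢 : 𝒢.Thm37Hypotheses) (c : TemperedPiChart 𝒢) {e : 𝒢.graph.Edge} {L L' : Subgroup c.G}
    (hL : L ∈ edgeLikeSubgroups c e) (hL' : L' ∈ edgeLikeSubgroups c e) (hc : Subgroup.Commensurable L L') :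
    L = L' := by
  classical
  have hVD := verticialDistinct_holds.{u}
  have hVI := verticialInjective_holds.{u}
  have hED : EdgeLikeDistinctAt 𝒢 := edgeLikeDistinctAt_of_compactInVerticialAt hCV
  haveI := TemperedPiChart.t2Space c
  -- a family of verticial homomorphisms
  have hΦ' : ∀ w : 𝒢.graph.Vertex, ∃ ψ : 𝒢.Gv w →ₜ* c.G, IsVerticialHom c w ψ := by
    intro w
    obtain ⟨K, ψ, hψ, -⟩ := (hVI 𝒢 h𝒢 c w).1
    exact ⟨ψ, hψ⟩
  choose Φ hΦ using hΦ'
  -- a branch `b` of `e` abutting to a vertex `v`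
  obtain ⟨w₀⟩ := h𝒢.hasVertex
  obtain ⟨b, hbe, hbs⟩ := SemiGraph.exists_abuts_of_isConnected h𝒢.isConnected w₀ e
  obtain ⟨v, hb⟩ := Option.isSome_iff_exists.mp hbs
  subst hbe
  -- presentations through `b` and the hosts
  obtain ⟨g, hLeq⟩ := edgeLike_eq_map_branchSubgroup c hb hL (Φ v) (hΦ v)
  obtain ⟨g', hL'eq⟩ := edgeLike_eq_map_branchSubgroup c hb hL' (Φ v) (hΦ v)
  set H := (Φ v).toMonoidHom.range.map (MulAut.conj g).toMonoidHom with hHdef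
  set H' := (Φ v).toMonoidHom.range.map (MulAut.conj g').toMonoidHom with hH'def
  have hH : H ∈ verticialSubgroups c v :=
    conj_mem_verticialSubgroups c (range_mem_verticialSubgroups c (Φ v) (hΦ v)) g
  have hH' : H' ∈ verticialSubgroups c v :=
    conj_mem_verticialSubgroups c (range_mem_verticialSubgroups c (Φ v) (hΦ v)) g'
  have hLH : L ≤ H := by rw [hLeq]; exact Subgroup.map_mono (Subgroup.map_le_range _ _)
  have hL'H' : L' ≤ H' := by rw [hL'eq]; exact Subgroup.map_mono (Subgroup.map_le_range _ _)
  -- `C = L' ∩ L` is compact and nontrivial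
  have hCc : IsCompact ((L' ⊓ L : Subgroup c.G) : Set c.G) := by
    rw [Subgroup.coe_inf]
    exact (isCompact_of_mem_edgeLikeSubgroups c hL').inter_right (isCompact_of_mem_edgeLikeSubgroups c hL).isClosed
  haveI := infinite_of_mem_edgeLikeSubgroups hVI h𝒢 c hL
  have hCne : L' ⊓ L ≠ ⊥ := by
    intro h0
    apply hc.2
    rw [Subgroup.relIndex, ← Subgroup.inf_subgroupOf_right, h0, Subgroup.bot_subgroupOf, Subgroup.index_bot]
    exact Nat.card_eq_zero_of_infinite
  -- the two hosts coincide
  have hHH' : H = H' := by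
    by_contra hne
    obtain ⟨honly, e', L'', he', hL'', hCL''⟩ :=
      (hCV h𝒢 c (L' ⊓ L) hCc).2 hCne v v H H' hH hH' hne (inf_le_right.trans hLH) (inf_le_left.trans hL'H')
    have hee : e' = 𝒢.graph.edgeOf b := by
      by_contra hee
      have h0 := hED h𝒢 c (𝒢.graph.edgeOf b) e' L L'' hL hL'' (Ne.symm hee)
      have hle : (L' ⊓ L).subgroupOf L ≤ L''.subgroupOf L := Subgroup.comap_mono hCL''
      have hdvd := Subgroup.index_dvd_of_le hle
      rw [Subgroup.relIndex] at h0
      rw [h0, zero_dvd_iff, Subgroup.inf_subgroupOf_right] at hdvd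
      exact hc.2 hdvd
    subst hee
    obtain ⟨b₁, b₂, u₁, u₂, h12, hb₁e, hb₂e, hb₁, hb₂⟩ := SemiGraph.exists_branches_of_isClosedEdge he'
    obtain ⟨bo, w, hbo, hboe, hbone⟩ : ∃ (bo : 𝒢.graph.Branch) (w : 𝒢.graph.Vertex),
        𝒢.graph.abuts bo = some w ∧ 𝒢.graph.edgeOf bo = 𝒢.graph.edgeOf b ∧ bo ≠ b := by
      by_cases hbb : b₁ = b
      · exact ⟨b₂, u₂, hb₂, hb₂e, fun h => h12 (hbb.trans h.symm)⟩
      · exact ⟨b₁, u₁, hb₁, hb₁e, hbb⟩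
    have hL''o : L'' ∈ edgeLikeSubgroups c (𝒢.graph.edgeOf bo) := by rw [hboe]; exact hL''
    obtain ⟨x₂, hL''eq⟩ := edgeLike_eq_map_branchSubgroup c hbo hL''o (Φ w) (hΦ w)
    set K₂ := (Φ w).toMonoidHom.range.map (MulAut.conj x₂).toMonoidHom with hK₂def
    have hK₂ : K₂ ∈ verticialSubgroups c w :=
      conj_mem_verticialSubgroups c (range_mem_verticialSubgroups c (Φ w) (hΦ w)) x₂
    have hL''K₂ : L'' ≤ K₂ := by rw [hL''eq]; exact Subgroup.map_mono (Subgroup.map_le_range _ _)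
    have hCbo : L' ⊓ L ≤ ((𝒢.branchSubgroup bo w hbo).map (Φ w).toMonoidHom).map (MulAut.conj x₂).toMonoidHom := by
      rw [← hL''eq]; exact hCL''
    rcases honly w K₂ hK₂ (hCL''.trans hL''K₂) with hK | hK
    · exact hbone (branch_eq_of_hosts_eq hVD hVI h𝒢 c Φ hΦ hCne hb hbo g x₂ (inf_le_right.trans hLeq.le) hCbo
        (hHdef ▸ hK.symm)).symm
    · exact hbone (branch_eq_of_hosts_eq hVD hVI h𝒢 c Φ hΦ hCne hb hbo g' x₂ (inf_le_left.trans hL'eq.le) hCbo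
        (hH'def ▸ hK.symm)).symm
  -- `g⁻¹ g' ∈ φ(Π_v)`: verticial subgroups are commensurably terminal (Thm. 3.7 (ii))
  have hmem : g⁻¹ * g' ∈ (Φ v).toMonoidHom.range := by
    by_contra hno
    have h0 := (hVD 𝒢 h𝒢 c).2 v _ (range_mem_verticialSubgroups c (Φ v) (hΦ v)) g g' hno
    change H'.relIndex H = 0 at h0
    rw [hHH', Subgroup.relIndex_self] at h0
    exact one_ne_zero h0
  obtain ⟨p, hp⟩ := hmem
  have hg' : g' = g * Φ v p := by
    rw [show (Φ v p : c.G) = g⁻¹ * g' from hp, mul_inv_cancel_left]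
  have hL'eq2 : L' = (((𝒢.branchSubgroup b v hb).map (MulAut.conj p).toMonoidHom).map (Φ v).toMonoidHom).map
      (MulAut.conj g).toMonoidHom := by
    rw [hL'eq, hg', map_conj_mul₃, ← map_conj_map_hom]
  -- aloofness: `Π_b ∼ p Π_b p⁻¹` forces `p ∈ Π_b`
  by_cases hpb : p ∈ 𝒢.branchSubgroup b v hb
  · rw [hL'eq2, map_conj_eq_self_of_mem₃ hpb, ← hLeq]
  · exfalso
    have h0 := (h𝒢.isTotallyAloof (𝒢.graph.edgeOf b)) b rfl v hb b hb p (Or.inr hpb)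
    refine hc.2 ?_
    have hinjg : Function.Injective (MulAut.conj g).toMonoidHom := (MulAut.conj g).injective
    have hinjΦ : Function.Injective (Φ v).toMonoidHom := (hVI 𝒢 h𝒢 c v).2 (Φ v) (hΦ v)
    rw [hL'eq2, hLeq, Subgroup.relIndex_map_map_of_injective _ _ hinjg,
      Subgroup.relIndex_map_map_of_injective _ _ hinjΦ]
    exact h0

/-- The same in the binder shape `hCT` of `SpecialFibreTower.exists_of_coverings_fibres` /
`CovObj.exists_galois_fibreActions`: under Thm. 3.7 (iii) AT `𝒢` the commensurable-rigidity hypothesis of the edge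
half of the Ex. 3.10 fibre actions is DISCHARGED, for every edge. [cite: MochizukiSemiAnbd2006, Thm 3.7(iii) pp.40-41] -/
theorem edgeLike_commensurable_rigid_of_compactInVerticialAt (hCV : CompactInVerticialAt 𝒢)
    (h𝒢 : 𝒢.Thm37Hypotheses) (c : TemperedPiChart 𝒢) :
    ∀ (e : 𝒢.graph.Edge) (L L' : Subgroup c.G), L ∈ edgeLikeSubgroups c e → L' ∈ edgeLikeSubgroups c e →
      Subgroup.Commensurable L L' → L = L' :=
  fun _ _ _ hL hL' hc => eq_of_commensurable_of_mem_edgeLikeSubgroups_of_compactInVerticialAt hCV h𝒢 c hL hL' hc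

end ProfiniteSemiGraph

end Literature.AnabelianGeometry.SemiGraphs

end
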